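import Summits.BirchSwinnertonDyer.BirchSwinnertonDyer.Theses.ErratumRoadFive
import Summits.BirchSwinnertonDyer.BirchSwinnertonDyer.Theorems.ErratumRoadFiveControlFromJSWMult
import Summits.BirchSwinnertonDyer.BirchSwinnertonDyer.Theorems.Rank1ResidualIntModelReduction
import Summits.BirchSwinnertonDyer.Rank1Residual.X11b.BDPRouteOpenInputFromLever
import Summits.BirchSwinnertonDyer.Rank1Residual.X5.TwoAdicInstancesToolkit
import Literature.NumberTheory.EllipticCurves.Rank1Residual.X9NoEntry
import HarnessLib

/-!
# Route `ErratumRoadFive` (rung K2, `p ≥ 5`): the PLAN-ONLY rung `(5595f1, 5)` of the registered skeletons of crux 19624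
# (`stub_rung_rest4_5595f1`) and of its (NW) child 19703 (`stub_rung_nw_5595f1`, same signature) — route p2's open input
# `P2OpenInputOnTreeAt E 5` at `E = 5595f1` (`N = 5595 ≥ 5000`; NON-split at `5`; REST⁗: `5 ∣ c₃ = 5`), from PUBLISHED
# named facts and ONE attested certificate (the canonical cyclotomic `5`-adic regulator is non-zero) — the cyclotomic LEVER
# road, where the Heegner-index certificate provably cannot reach (`ord₅ [E(K):ℤy_K] = 1` at every Heegner field)

Cell `bsd-stepL` (run/shared/lean/pub/bsd-stepL/), seat `bsd-stepL-rest-p2` (prover g0, 2026-08-26);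
`--supports stmt-BirchSwinnertonDyer-19703 --as helper` (conclusion = the REGISTERED signature of `stub_rung_nw_5595f1` =
`stub_rung_rest4_5595f1` VERBATIM; hypotheses = published named facts + the lever's published facts + ONE certificate binder
`hReg`; same architecture as this seat's `rung_5190r1_of_regCert`, p453225).

HONEST FRAMING: THEOREMS ONLY (no definition, no named fact, no `sorry`, no `native_decide`; axioms standard); nothing is
booked; BSD is proved for no class; ONE curve; CONDITIONAL on the displayed published facts AND on the certificate binder
`hReg : ClassClosure.RegulatorNonvanishingAt E 5` (Schneider AT THIS PAIR — at a NON-split `5` the Stein–Wuthrich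
`IsMultCanonical` datum; a finite `5`-adic computation attested by kit j255562 with PARI `ellpadicregulator`, not
kernel-checked today). WHY THIS ROAD: this pair was the planner's witness that «the certificate must absorb ord₅ c₃ = 1» —
seat rest-p2's kit j255090 found the Heegner index `m = 5` at `d = −59` and `m = 10` at `d = −179` (ord₅ = 1 at every
Heegner field, Gross–Zagier × the Tamagawa factor `c₃ = 5`), so Kolyvagin's index certificate yields only `#Ш(E/K)[5^∞] ≤ 5²`
(RUNG-5015b1-CERT.md §2); the lever (Skinner 2016 Thm. A + Stein–Wuthrich 2013 Thm. 6.1/§4.2 + Disegni 2020 Thm. 1 + GZK +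
parametrisation: «any `#Ш_an`, no Tamagawa ∕ Heegner-index ∕ anticyclotomic hypothesis») reads `BSD(E,5)` off `Reg₅ ≠ 0`
instead, with NO preprint input. PARTITION (D-0054): X11b@p≥5 (B9 ∕ N8) × the pair `(5595f1, 5)` (an (NW) ∩ off-Locus pair:
(ram), `E(ℚ₅)[5] = 0`, no odd non-split witness, `5 ∣ ∏c`) × `p = 5 ∥ N = 5595` — types-the-object-of; closes: none.

THE PAIR (Cremona; planner g25's scan; seat rest-p2 kit j255090 ∕ j255562): `E = 5595f1 = [1, 0, 0, −71, −234]`,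
`y² + xy = x³ − 71x − 234`, `N = 5595 = 3·5·373`, `Δ = 453195 = 3⁵·5·373`, `c₄ = 3409 = 7·487` (`gcd = 1`: semistable,
minimal); SPLIT multiplicative at `3` (`v₃(Δ) = c₃ = 5`: the carrier of `5` in `∏c`, NOT a (ram) witness since
`5 ∣ v₃(Δ)`) and at `373` (`v = 1`, `c = 1`: THE (ram) witness), NON-split at `5` (`a₅ = −1`, `v₅(Δ) = 1`, `c₅ = 1`, so
`E(ℚ₅)[5] = 0`); `∏c = 5`; `E(ℚ)_tors = 1`; `r_an = 1`, `E(ℚ) = ℤ·(−5, 4)`, `Ш_an = 1.000…`; `#Ẽ(𝔽₇) = 7` (`a₇ = 1`).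
KERNEL-DECIDED here (§§1–2): `Δ`, `c₄`, ellipticity, global minimality, `N = 5595 ≥ 5000`, multiplicative at `5` and `373`,
`v₃₇₃(Δ_min) = 1` hence the (ram) witness, `v₅(Δ_min) = 1`, `#Ẽ(𝔽₇) = 7` hence `E[5]` irreducible (`X² − X + 7` root-free
mod `5`) and `ρ̄_{E,5}` onto. NOT decided (carried by the `ClassX11b` binder INSIDE the predicate): `r_an = 1`.

THE CERTIFICATE (kit j255562, gp 2.17.3; HOME/rest/RUNG-5595f1-REG-CERT.md): at `g = (−5, 4)` (Cremona's generator; `ellrank` + saturation at all primes `≤ 200` agree; `ĥ`-ratio 1) PARI 2.17.3's canonical cyclotomic regulator `R = ellpadicregulator(E, 5, 25, [g]) = 4 + 4·5 + 3·5² + 5³ + 2·5⁵ + … + O(5²⁵)` is a `5`-adic UNIT (`v₅(R) = 0`; raw `ellpadicheight` coordinates `v₅(A) = 0`, `v₅(B) = 2`, `v₅(s₂) = 0`; Tate `v(q) = 1`, `u ∉ ℚ₅` — non-split);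
in rank one `Reg₅(E) = R·[E(ℚ)/tors : ℤg]⁻²`, so `Reg₅ ≠ 0` — the content of the binder `hReg` (the tree's `IsMultCanonical` datum at a non-split `p`, `ClassClosureTyped`).

THE RUNG (§3) `rung_5595f1_of_regCert`: inside the predicate's binders (`ClassX11b E 5` ⟹ `r_an = 1`; `5 ≤ 5`) the lever
`ClassClosure.bsdp_of_leverLocus_of_regulatorNonvanishing` gives `BSD(E,5)` from `hReg`; multr1-p2's tightness
`P2.openInputOnTreeAt_of_bsdp_of_ram` with the Jetchev–Skinner–Wan control identity and the kernel-decided (ram) witness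
`373` gives the open input. §4 `rung_5595f1_of_items`: the same over the route's support items BY NAME
(`PublishedInputsFive` 19066, `JSWAnticyclotomicControlMult` 19626) + the lever-fact conjunction (= the registered
fact-stub statement `stub_t_leverFacts` of the (T) skeleton, verbatim) + `hReg`. Why outside S's known regime (BC5):
`N = 5595 ≥ 5000`; at `5 ∥ N` with `5 ∣ c₃` no printed class-wide theorem gives `BSD(E,5)` without Schneider's conjecture,
and the (ram) Kolyvagin certificate is excluded by the Tamagawa factor.

References: [Skinner2016PacificMC] Thm. A, Thm. C; [SteinWuthrich2013] Thm. 6.1, §4.2; [Disegni2020] Thm. 1;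
[Schneider1982PadicHeightI] §1; [JetchevSkinnerWan2017] Thm. 3.3.1, §7.4.1; [Castella2018] Thm. 2.3, (1.1);
[SilvermanAEC2009] VII.1 Rem. 1.1, VII.5 Prop. 5.1; [Silverman1994] IV.10.2; [Mazur1978] Prop. 6.3 (1); [Serre1972]
Prop. 15; [SkinnerUrban2014] Thm. 2; [Cremona1997] Table 1 (5595f1).
-/

set_option autoImplicit false
-- the Theorems namespace of this sub repeats the summit name by design (D-0017 nested layout)
set_option linter.dupNamespace false

noncomputable section

open scoped Classical

open WeierstrassCurve IsDedekindDomain NumberField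
  Literature.NumberTheory.EllipticCurves Literature.NumberTheory.EllipticCurves.ModularForms
  Literature.NumberTheory.EllipticCurves.Rank1Residual
  Literature.NumberTheory.EllipticCurves.Rank1Residual.Typed
  Literature.NumberTheory.EllipticCurves.JetchevSkinnerWan2017
  Literature.NumberTheory.EllipticCurves.SteinWuthrich2013
  Literature.NumberTheory.EllipticCurves.Disegni2020
  Literature.NumberTheory.EllipticCurves.Skinner2016
  Summit.BirchSwinnertonDyer.Rank1Residual Summit.BirchSwinnertonDyer.Rank1Residual.X11b
  Summit.BirchSwinnertonDyer.BirchSwinnertonDyer.Rank1Residual.IntModel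
  Summit.BirchSwinnertonDyer.BirchSwinnertonDyer.Theses.ErratumRoadFive

namespace Summit.BirchSwinnertonDyer.BirchSwinnertonDyer.Theorems

/-! ## §1 The model `5595f1` and its kernel-decided invariants (written LITERALLY: `M = ⟨1, 0, 0, −71, −234⟩`) -/

/-- `Δ(5595f1) = 453195 = 3⁵·5·373`. [cite: Cremona1997, Table 1 (curve 5595f1)] -/
theorem M5595f1_Δ : (⟨1, 0, 0, -71, -234⟩ : WeierstrassCurve ℤ).Δ = 453195 := by decide

/-- `c₄(5595f1) = 3409 = 7·487`. [cite: Cremona1997, Table 1 (curve 5595f1)] -/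
theorem M5595f1_c₄ : (⟨1, 0, 0, -71, -234⟩ : WeierstrassCurve ℤ).c₄ = 3409 := by decide

/-- `5595f1` is an elliptic curve (`Δ ≠ 0`). [cite: SilvermanAEC2009, III.1] -/
theorem isElliptic_5595f1 : ((⟨1, 0, 0, -71, -234⟩ : WeierstrassCurve ℤ).baseChange ℚ).IsElliptic := by
  rw [WeierstrassCurve.isElliptic_iff, baseChange_int_Δ, M5595f1_Δ]; norm_num

/-- Cremona's model of `5595f1` is globally minimal (`gcd(Δ, c₄) = 1`). [cite: SilvermanAEC2009, VII.1 Remark 1.1] -/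
theorem isGloballyMinimal_5595f1 :
    ((⟨1, 0, 0, -71, -234⟩ : WeierstrassCurve ℤ).baseChange ℚ).IsGloballyMinimal :=
  X5.Instances.isGloballyMinimal_baseChange_int_of_gcd_eq_one 1 0 0 (-71) (-234) (by decide)

/-- `Δ(5595f1)` and `c₄(5595f1)` are coprime (a semistable model). [cite: SilvermanAEC2009, VII.5 Prop. 5.1(b)] -/
theorem M5595f1_coprime :
    IsCoprime (⟨1, 0, 0, -71, -234⟩ : WeierstrassCurve ℤ).Δ (⟨1, 0, 0, -71, -234⟩ : WeierstrassCurve ℤ).c₄ := by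
  rw [M5595f1_Δ, M5595f1_c₄, Int.isCoprime_iff_gcd_eq_one]; decide

/-- **`N(5595f1) = 5595 = 3·5·373`** (semistable: `N = rad Δ`, `Δ ∣ 5595⁵`). [cite: Silverman1994, IV.10.2 (a),(b)]
[cite: Cremona1997, Table 1 (curve 5595f1)] -/
theorem conductorNorm_5595f1 [((⟨1, 0, 0, -71, -234⟩ : WeierstrassCurve ℤ).baseChange ℚ).IsElliptic] :
    ((⟨1, 0, 0, -71, -234⟩ : WeierstrassCurve ℤ).baseChange ℚ).conductorNorm ℤ = 5595 := by
  refine X5.Instances.conductorNorm_baseChange_int_of_isCoprime (⟨1, 0, 0, -71, -234⟩ : WeierstrassCurve ℤ)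
    M5595f1_coprime (k := 5) ?_ ?_ ?_
  · exact Nat.squarefree_mul_iff.mpr ⟨by norm_num, (show Nat.Prime 3 by norm_num).prime.squarefree,
      Nat.squarefree_mul_iff.mpr ⟨by norm_num, (show Nat.Prime 5 by norm_num).prime.squarefree,
        (show Nat.Prime 373 by norm_num).prime.squarefree⟩⟩
  · rw [M5595f1_Δ]; norm_num
  · rw [M5595f1_Δ]; norm_num

/-- **`N(5595f1) ≥ 5000`**: outside the printed per-curve verifications of BSD. [cite: Miller2011LMS, Thm. 1.2 and §1] -/
theorem conductorNorm_5595f1_ge [((⟨1, 0, 0, -71, -234⟩ : WeierstrassCurve ℤ).baseChange ℚ).IsElliptic] :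
    5000 ≤ ((⟨1, 0, 0, -71, -234⟩ : WeierstrassCurve ℤ).baseChange ℚ).conductorNorm ℤ := by
  rw [conductorNorm_5595f1]; norm_num

/-! ## §2 Local data: multiplicative at `5` and `373`; the (ram) witness `373`; `E[5]` irreducible; `ρ̄₅` onto -/

/-- **Multiplicative reduction at `5`** (`5 ∣ Δ`, `5 ∤ c₄`). [cite: SilvermanAEC2009, VII.5 Prop. 5.1(b)] -/
theorem mult_five_5595f1 [((⟨1, 0, 0, -71, -234⟩ : WeierstrassCurve ℤ).baseChange ℚ).IsElliptic]
    [((⟨1, 0, 0, -71, -234⟩ : WeierstrassCurve ℤ).baseChange ℚ).IsGloballyMinimal] :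
    Mult ((⟨1, 0, 0, -71, -234⟩ : WeierstrassCurve ℤ).baseChange ℚ) 5 :=
  hasMultiplicativeReductionAtPrime_of_intModel (integralModelInt_baseChange_int _) 5
    (by rw [M5595f1_Δ]; decide) (by rw [M5595f1_c₄]; decide)

/-- **Multiplicative reduction at `373`** (`373 ∣ Δ`, `373 ∤ c₄`; the `Fact` binder supplies primality). [cite: SilvermanAEC2009, VII.5 Prop. 5.1(b)] -/
theorem mult_373_5595f1 [Fact (Nat.Prime 373)]
    [((⟨1, 0, 0, -71, -234⟩ : WeierstrassCurve ℤ).baseChange ℚ).IsElliptic]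
    [((⟨1, 0, 0, -71, -234⟩ : WeierstrassCurve ℤ).baseChange ℚ).IsGloballyMinimal] :
    Mult ((⟨1, 0, 0, -71, -234⟩ : WeierstrassCurve ℤ).baseChange ℚ) 373 :=
  hasMultiplicativeReductionAtPrime_of_intModel (integralModelInt_baseChange_int _) 373
    (by rw [M5595f1_Δ]; decide) (by rw [M5595f1_c₄]; decide)

/-- `v₃₇₃(Δ_min(5595f1)) = 1` — so `5 ∤ v₃₇₃(Δ_min)`: `E[5]` is ramified at `373`. [cite: SilvermanAEC2009, VII.5 Prop. 5.1(b)] -/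
theorem padicValInt_373_minimalDiscriminant_5595f1 [Fact (Nat.Prime 373)]
    [((⟨1, 0, 0, -71, -234⟩ : WeierstrassCurve ℤ).baseChange ℚ).IsGloballyMinimal] :
    padicValInt 373 ((⟨1, 0, 0, -71, -234⟩ : WeierstrassCurve ℤ).baseChange ℚ).minimalDiscriminantInt = 1 := by
  rw [minimalDiscriminantInt_baseChange_int, M5595f1_Δ]
  exact padicValInt_eq_of_dvd_of_not_dvd 373 (by decide) (by decide)

/-- `v₅(Δ_min(5595f1)) = 1` (Kodaira I₁ at the NON-split prime `5`; `c₅ = 1`; the carrier of `5` in `∏c` is `c₃ = 5`).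
[cite: SilvermanAEC2009, VII.5 Prop. 5.1(b)] -/
theorem padicValInt_five_minimalDiscriminant_5595f1
    [((⟨1, 0, 0, -71, -234⟩ : WeierstrassCurve ℤ).baseChange ℚ).IsGloballyMinimal] :
    padicValInt 5 ((⟨1, 0, 0, -71, -234⟩ : WeierstrassCurve ℤ).baseChange ℚ).minimalDiscriminantInt = 1 := by
  rw [minimalDiscriminantInt_baseChange_int, M5595f1_Δ]
  exact padicValInt_eq_of_dvd_of_not_dvd 5 (by decide) (by decide)

/-- **The (ram) witness at `p = 5`**: `373 ≠ 5` is multiplicative with `5 ∤ v₃₇₃(Δ_min) = 1`.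
[cite: SkinnerUrban2014, Thm. 2 (p. 3), second bullet] -/
theorem ram_five_5595f1 [((⟨1, 0, 0, -71, -234⟩ : WeierstrassCurve ℤ).baseChange ℚ).IsElliptic]
    [((⟨1, 0, 0, -71, -234⟩ : WeierstrassCurve ℤ).baseChange ℚ).IsGloballyMinimal] :
    Ram ((⟨1, 0, 0, -71, -234⟩ : WeierstrassCurve ℤ).baseChange ℚ) 5 :=
  ram_of_intModel (integralModelInt_baseChange_int _) 5 373 (by norm_num) (by decide)
    (by rw [M5595f1_Δ]; decide) (by rw [M5595f1_c₄]; decide) (e := 1)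
    (by rw [M5595f1_Δ]; decide) (by rw [M5595f1_Δ]; decide) (by decide)

/-- `#Ẽ(𝔽₇) = 7` for `5595f1` (`a₇ = 7 + 1 − 7 = 1`), kernel-decided on the `49` pairs of `𝔽₇²`. [cite: SilvermanAEC2009, V.2] -/
theorem card_F7_5595f1 :
    Nat.card (((⟨1, 0, 0, -71, -234⟩ : WeierstrassCurve ℤ).map (Int.castRingHom (ZMod 7))).toAffine.Point) = 7 := by
  rw [@natCard_point_eq_one_add_card (ZMod 7) (@ZMod.instField 7 ⟨by norm_num⟩) _ _ _ (by decide)]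
  decide

/-- **`E[5]` irreducible for `5595f1`**: Frobenius no-root witness at the good prime `ℓ = 7` (`a₇ = 1`, `X² − X + 7`
root-free mod `5`; Mazur 1978 Prop. 6.3 (1)). [cite: Mazur1978, §5 (p. 148) and §6 Prop. 6.3 (1) (p. 153)] -/
theorem irr_five_5595f1 [((⟨1, 0, 0, -71, -234⟩ : WeierstrassCurve ℤ).baseChange ℚ).IsElliptic]
    [((⟨1, 0, 0, -71, -234⟩ : WeierstrassCurve ℤ).baseChange ℚ).IsGloballyMinimal] :
    Irr ((⟨1, 0, 0, -71, -234⟩ : WeierstrassCurve ℤ).baseChange ℚ) 5 :=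
  haveI : Fact (Nat.Prime 7) := ⟨by norm_num⟩
  hasIrreducibleModPGaloisRep_of_intModel_of_noroot (integralModelInt_baseChange_int _) 5 7
    (by decide) (by rw [M5595f1_Δ]; decide) card_F7_5595f1 (by decide)

/-- **`ρ̄_{E,5}` is onto for `5595f1`** (irr ∧ ram), so the open input at this pair is NOT vacuous. [cite: Serre1972, §2.4 Prop. 15] -/
theorem surj_five_5595f1 [((⟨1, 0, 0, -71, -234⟩ : WeierstrassCurve ℤ).baseChange ℚ).IsElliptic]
    [((⟨1, 0, 0, -71, -234⟩ : WeierstrassCurve ℤ).baseChange ℚ).IsGloballyMinimal] :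
    Surj ((⟨1, 0, 0, -71, -234⟩ : WeierstrassCurve ℤ).baseChange ℚ) 5 :=
  surj_of_irr_of_ram _ 5 irr_five_5595f1 ram_five_5595f1

/-! ## §3 The rung: the open input at `(5595f1, 5)` from published facts + ONE attested REG certificate -/

/-- **PLAN-ONLY RUNG `stub_rung_nw_5595f1` (19703) = `stub_rung_rest4_5595f1` (19624) — registered signature VERBATIM as
conclusion — at the REST⁗ pair `(5595f1, 5)`, from PUBLISHED named facts and ONE attested certificate `hReg` (the canonical
`5`-adic regulator is non-zero at this pair; NON-split `5`).** Published binders: Gross–Zagier `hGZ`, Kolyvagin `hKo`, Skinner 2016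
Thm. C `hSk`, GZK `hGZK`, modularity `hmod` (tightness), the Jetchev–Skinner–Wan control fact `h331`, and the lever's
Skinner 2016 Thm. A `hSkA`, Stein–Wuthrich Thm. 6.1 `hJn hJs` and §4.2 `hHn hHs`, Disegni Thm. 1 `hD`, parametrisation
`hpar`. Proof: inside the predicate's binders the lever gives `BSD(E,5)` from `hReg`; tightness + JSW control + the
kernel-decided (ram) witness `373` give the open input. CONDITIONAL on every binder; ONE curve; nothing booked.
[cite: Skinner2016PacificMC, Thm. A and Thm. C (§1)] [cite: SteinWuthrich2013, Thm. 6.1 (p. 20), §4.2]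
[cite: Disegni2020, Thm. 1 (§1.2)] [cite: Schneider1982PadicHeightI, §1] [cite: JetchevSkinnerWan2017, Thm. 3.3.1 and §7.4.1]
[cite: Castella2018, Thm. 2.3 (p. 5), (1.1) (p. 2)] [cite: Cremona1997, Table 1 (curve 5595f1)] -/
theorem rung_5595f1_of_regCert
    [((⟨1, 0, 0, -71, -234⟩ : WeierstrassCurve ℤ).baseChange ℚ).IsElliptic]
    [((⟨1, 0, 0, -71, -234⟩ : WeierstrassCurve ℤ).baseChange ℚ).IsGloballyMinimal]
    -- published named facts (tightness + control)
    (hGZ : ∀ (N : ℕ) [NeZero N] (W : WeierstrassCurve ℚ) (K : Type) [Field K] [NumberField K],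
      gross_zagier N W K)
    (hKo : ∀ (N : ℕ) [NeZero N] (W : WeierstrassCurve ℚ) (K : Type) [Field K] [NumberField K],
      kolyvagin N W K)
    (hSk : Skinner2016.thmC_padicValRat_bsd_rank_zero)
    (hGZK : rank_eq_analyticRank_of_analyticRank_le_one) (hmod : hasEntireLFunction_rat)
    (h331 : thm331_anticyclotomicControl_mult)
    -- the lever's published facts
    (hSkA : thmA_charIdeal_multiplicative)
    (hJn : thm61_nonsplitMultiplicative) (hJs : thm61_splitMultiplicative)
    (hHn : exists_isMultCanonical) (hHs : exists_isSplitMultCanonical)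
    (hD : thm1_padicBSD_rankOne_multiplicative) (hpar : nonempty_modularParametrizationData)
    -- the attested certificate (kit j255562): the canonical 5-adic regulator at (5595f1, 5) is non-zero
    (hReg : ClassClosure.RegulatorNonvanishingAt ((⟨1, 0, 0, -71, -234⟩ : WeierstrassCurve ℤ).baseChange ℚ) 5) :
    Summit.BirchSwinnertonDyer.Rank1Residual.X11b.P2OpenInputOnTreeAt
      ((⟨1, 0, 0, -71, -234⟩ : WeierstrassCurve ℤ).baseChange ℚ) 5 := by
  refine p2OpenInputOnTreeAt_of_imp_surj _ 5 fun hX hp5 _ ↦ ?_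
  exact P2.openInputOnTreeAt_of_bsdp_of_ram _ 5 hGZ hKo hSk hGZK hmod (p2ControlOnTreeAt_of_thm331Mult _ 5 h331 hKo)
    ram_five_5595f1
    (ClassClosure.bsdp_of_leverLocus_of_regulatorNonvanishing _ 5 hSkA hJn hJs hHn hHs hD hGZK hpar hX
      (ClassClosure.leverLocusAt_of_ram_of_five_le _ 5 ram_five_5595f1 hp5) hReg)

/-! ## §4 The same over the route's support items and the registered fact-stub F2 BY NAME -/

/-- **The rung with the published facts bound BY THE ROUTE'S NAMES**: `PublishedInputsFive` (19066) +
`JSWAnticyclotomicControlMult` (19626) + the lever-fact conjunction (verbatim the (T) skeleton's fact-stub `stub_t_leverFacts`)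
+ the certificate `hReg` ⟹ the registered statement of `stub_rung_nw_5595f1` ∕ `stub_rung_rest4_5595f1`. CONDITIONAL; ONE curve.
[cite: Skinner2016PacificMC, Thm. A (§1)] [cite: SteinWuthrich2013, Thm. 6.1, §4.2] [cite: Disegni2020, Thm. 1 (§1.2)] -/
theorem rung_5595f1_of_items
    [((⟨1, 0, 0, -71, -234⟩ : WeierstrassCurve ℤ).baseChange ℚ).IsElliptic]
    [((⟨1, 0, 0, -71, -234⟩ : WeierstrassCurve ℤ).baseChange ℚ).IsGloballyMinimal]
    (hF : PublishedInputsFive) (h331 : JSWAnticyclotomicControlMult)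
    (hL : thmA_charIdeal_multiplicative ∧ thm61_nonsplitMultiplicative ∧ thm61_splitMultiplicative ∧
      exists_isMultCanonical ∧ exists_isSplitMultCanonical ∧ thm1_padicBSD_rankOne_multiplicative ∧
      nonempty_modularParametrizationData)
    (hReg : ClassClosure.RegulatorNonvanishingAt ((⟨1, 0, 0, -71, -234⟩ : WeierstrassCurve ℤ).baseChange ℚ) 5) :
    Summit.BirchSwinnertonDyer.Rank1Residual.X11b.P2OpenInputOnTreeAt
      ((⟨1, 0, 0, -71, -234⟩ : WeierstrassCurve ℤ).baseChange ℚ) 5 := by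
  obtain ⟨hGZ, hKo, -, hSk, -, hGZK, hmod, -, -, -, -, -, -, -, -⟩ := hF
  obtain ⟨hSkA, hJn, hJs, hHn, hHs, hD, hpar⟩ := hL
  exact rung_5595f1_of_regCert hGZ hKo hSk hGZK hmod h331 hSkA hJn hJs hHn hHs hD hpar hReg

end Summit.BirchSwinnertonDyer.BirchSwinnertonDyer.Theorems

end
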